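import Mathlib
import Literature.Analysis.FluidPDE.SuitableWeak
import Literature.Analysis.FluidPDE.AxisymmetricTypeIOffAxis
import Literature.Analysis.FunctionSpaces.SobolevDomainProofs
import Summits.NavierStokesRegularity.NavierStokesRegularity.Theorems.EulerZoomLiouvillePowerGaugeEulerLiouvillePastFrameSteadyConfined
import Summits.NavierStokesRegularity.NavierStokesRegularity.Theorems.TypeILiouvilleTypeIliouvilleNoTypeIIPowerGaugeSteady
import Summits.NavierStokesRegularity.NavierStokesRegularity.Theorems.EulerZoomLiouvillePowerGaugeEulerLiouvilleTimePeriodicTools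
import Summits.NavierStokesRegularity.NavierStokesRegularity.Theorems.EulerZoomLiouvillePowerGaugeEulerLiouvillePastTimePeriodic
import Summits.NavierStokesRegularity.NavierStokesRegularity.Theorems.EulerZoomLiouvillePowerGaugeEulerLiouvillePastSymmetric
import HarnessLib

/-!
# TWISTED TOOLS: weak derivatives and gauge slice masses under linear isometries
# (line `relative-equilibria`, stub R1 `stub_twistedClock`; crux = stmt-NavierStokesRegularity-19832)

Route `EulerZoomLiouville` (NavierStokesRegularity); width seat ns-ezl-w6 g2 (LEAD ns-typeII-p2 g12; line `relative-equilibria` of ns-idea-11 g6, 2026-08-28).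
The equation-free slice machinery of `…PastFrameSteadyConfined` (slices of the weak gradient are weak derivatives of the slices) transported
under LINEAR ISOMETRIES `R` of `ℝ³` (which fix the origin, hence the balls and cylinders of the three gauges):
* `Twisted.isTestFunctionOn_top_comp` — test functions on `ℝ³` pull back under `R`;
* `Twisted.hasWeakFDerivOn_conj` — if `g` is a weak derivative of `f` on `ℝ³` then `x ↦ R ∘ g(R⁻¹x) ∘ R⁻¹` is a weak derivative of
  `x ↦ R(f(R⁻¹x))` (change of variables `x = Ry`, `LinearIsometryEquiv.integral_comp_comm`, the chain rule `ContinuousLinearEquiv.comp_right_fderiv`);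
* `Twisted.setLIntegral_ball_comp` — `∫_{B_r} F(Ry) dy = ∫_{B_r} F`; with the tree's `frobeniusNormSq_conj_linearIsometryEquiv`,
  `Twisted.sliceMass_conj` — the gauge slice mass `∫_{B_r} |R ∘ G(R⁻¹·) ∘ R⁻¹|²_F = ∫_{B_r} |G|²_F`;
* `Twisted.ae_eq_conj_of_hasWeakFDerivOn` — two slices that are isometric conjugates, `u(τ) = R ∘ u(τ') ∘ R⁻¹`, have conjugate weak-gradient
  slices a.e. (uniqueness of weak derivatives);
* bookkeeping shared by the strata: Tonelli on window boxes (`setLIntegral_box_eq_iterate`), zero ball masses ⇒ zero slice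
  (`slice_ae_zero_of_ballMass_zero`), and «weak-gradient slices vanish below `T₁` ⇒ the member is trivial» (`ae_eq_zero_of_weakGradient_slices_zero`:
  `PowerGaugeSteady.ae_slice_const_of_weakGradient_ae_zero` + `PastPeriodic.lintegral_slice_eq_zero_of_ae_const_of_gaugeA` + `PastSymmetric…pastSlicesZero`).
WHAT THIS IS NOT: not NS, not E — tools for strata of the crux CLASS on the MODEL lattice (`--supports` stmt-19832); 19832 OPEN. [folklore]
-/

noncomputable section

set_option linter.dupNamespace false -- flat `Theorems/<Route><Decl>…` files share the crux namespace `Summit.<S>.<S>.…`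

open MeasureTheory Set Filter Topology Metric Function TopologicalSpace
open scoped ENNReal NNReal

namespace Summit.NavierStokesRegularity.NavierStokesRegularity.Theorems.PowerGaugeEulerLiouville

open Literature.Analysis Literature.Analysis.FunctionSpaces Literature.Analysis.FluidPDE

namespace Twisted

/-- `(R ∘ A ∘ R⁻¹) v = R (A (R⁻¹ v))`. [folklore] -/
theorem conj_apply (R : EuclideanSpace ℝ (Fin 3) ≃ₗᵢ[ℝ] EuclideanSpace ℝ (Fin 3))
    (A : EuclideanSpace ℝ (Fin 3) →L[ℝ] EuclideanSpace ℝ (Fin 3)) (v : EuclideanSpace ℝ (Fin 3)) :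
    ((R : EuclideanSpace ℝ (Fin 3) →L[ℝ] EuclideanSpace ℝ (Fin 3)).comp ((A).comp ((R).symm : EuclideanSpace ℝ (Fin 3) →L[ℝ] EuclideanSpace ℝ (Fin 3)))) v = R (A (R.symm v)) := rfl

/-- Conjugation is continuous in `A`. [folklore] -/
theorem continuous_conj (R : EuclideanSpace ℝ (Fin 3) ≃ₗᵢ[ℝ] EuclideanSpace ℝ (Fin 3)) :
    Continuous fun A : EuclideanSpace ℝ (Fin 3) →L[ℝ] EuclideanSpace ℝ (Fin 3) => ((R : EuclideanSpace ℝ (Fin 3) →L[ℝ] EuclideanSpace ℝ (Fin 3)).comp ((A).comp ((R).symm : EuclideanSpace ℝ (Fin 3) →L[ℝ] EuclideanSpace ℝ (Fin 3)))) :=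
  continuous_const.clm_comp (continuous_id.clm_comp continuous_const)

/-- Conjugation does not increase the operator norm. [folklore] -/
theorem norm_conj_le (R : EuclideanSpace ℝ (Fin 3) ≃ₗᵢ[ℝ] EuclideanSpace ℝ (Fin 3))
    (A : EuclideanSpace ℝ (Fin 3) →L[ℝ] EuclideanSpace ℝ (Fin 3)) :
    ‖((R : EuclideanSpace ℝ (Fin 3) →L[ℝ] EuclideanSpace ℝ (Fin 3)).comp ((A).comp ((R).symm : EuclideanSpace ℝ (Fin 3) →L[ℝ] EuclideanSpace ℝ (Fin 3))))‖ ≤ ‖A‖ := by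
  have h1 : ‖(R : EuclideanSpace ℝ (Fin 3) →L[ℝ] EuclideanSpace ℝ (Fin 3))‖ ≤ 1 := R.toLinearIsometry.norm_toContinuousLinearMap_le
  have h2 : ‖(R.symm : EuclideanSpace ℝ (Fin 3) →L[ℝ] EuclideanSpace ℝ (Fin 3))‖ ≤ 1 :=
    R.symm.toLinearIsometry.norm_toContinuousLinearMap_le
  calc ‖((R : EuclideanSpace ℝ (Fin 3) →L[ℝ] EuclideanSpace ℝ (Fin 3)).comp ((A).comp ((R).symm : EuclideanSpace ℝ (Fin 3) →L[ℝ] EuclideanSpace ℝ (Fin 3))))‖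
      ≤ ‖(R : EuclideanSpace ℝ (Fin 3) →L[ℝ] EuclideanSpace ℝ (Fin 3))‖ *
        ‖A.comp (R.symm : EuclideanSpace ℝ (Fin 3) →L[ℝ] EuclideanSpace ℝ (Fin 3))‖ := ContinuousLinearMap.opNorm_comp_le _ _
    _ ≤ 1 * (‖A‖ * 1) := by
        refine mul_le_mul h1 ((ContinuousLinearMap.opNorm_comp_le _ _).trans (mul_le_mul_of_nonneg_left h2 (norm_nonneg _)))
          (norm_nonneg _) zero_le_one
    _ = ‖A‖ := by ring

/-! ## Test functions and weak derivatives under a linear isometry -/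

/-- **Test functions on `ℝ³` pull back under a linear isometry.** [folklore] -/
theorem isTestFunctionOn_top_comp (R : EuclideanSpace ℝ (Fin 3) ≃ₗᵢ[ℝ] EuclideanSpace ℝ (Fin 3)) {φ : EuclideanSpace ℝ (Fin 3) → ℝ}
    (hφ : IsTestFunctionOn (⊤ : Opens (EuclideanSpace ℝ (Fin 3))) φ) :
    IsTestFunctionOn (⊤ : Opens (EuclideanSpace ℝ (Fin 3))) fun y => φ (R y) :=
  ⟨hφ.contDiff.comp R.toContinuousLinearEquiv.contDiff, hφ.hasCompactSupport.comp_homeomorph R.toHomeomorph, fun _ _ => trivial⟩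

/-- **WEAK DERIVATIVES UNDER ISOMETRIC CONJUGATION.**  If `g` is a weak derivative of `f : ℝ³ → ℝ³` on `ℝ³`, then `x ↦ R ∘ g(R⁻¹x) ∘ R⁻¹` is a weak
derivative of `x ↦ R(f(R⁻¹x))` (`x = Ry`: `∫ ∂ᵥφ(x) R f(R⁻¹x) dx = R ∫ ∂_{R⁻¹v}(φ∘R)(y) f(y) dy = −R ∫ (φ∘R) g(y)(R⁻¹v) = −∫ φ(x) R g(R⁻¹x)(R⁻¹v) dx`). [folklore] -/
theorem hasWeakFDerivOn_conj (R : EuclideanSpace ℝ (Fin 3) ≃ₗᵢ[ℝ] EuclideanSpace ℝ (Fin 3))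
    {f : EuclideanSpace ℝ (Fin 3) → EuclideanSpace ℝ (Fin 3)} {g : EuclideanSpace ℝ (Fin 3) → EuclideanSpace ℝ (Fin 3) →L[ℝ] EuclideanSpace ℝ (Fin 3)}
    (h : HasWeakFDerivOn (⊤ : Opens (EuclideanSpace ℝ (Fin 3))) volume f g) :
    HasWeakFDerivOn (⊤ : Opens (EuclideanSpace ℝ (Fin 3))) volume (fun x => R (f (R.symm x))) fun x => ((R : EuclideanSpace ℝ (Fin 3) →L[ℝ] EuclideanSpace ℝ (Fin 3)).comp ((g (R.symm x)).comp ((R).symm : EuclideanSpace ℝ (Fin 3) →L[ℝ] EuclideanSpace ℝ (Fin 3)))) := by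
  have hmp := R.measurePreserving
  have hmp' := R.symm.measurePreserving
  have hme : MeasurableEmbedding R := R.toMeasurableEquiv.measurableEmbedding
  -- local integrability through the homeomorphism `R⁻¹`
  have hli : ∀ {F : Type} [NormedAddCommGroup F] {k : EuclideanSpace ℝ (Fin 3) → F},
      LocallyIntegrableOn k ((⊤ : Opens (EuclideanSpace ℝ (Fin 3))) : Set (EuclideanSpace ℝ (Fin 3))) volume →
        LocallyIntegrable (fun x => k (R.symm x)) volume := by
    intro F _ k hk
    rw [Opens.coe_top, locallyIntegrableOn_univ] at hk
    exact (locallyIntegrable_map_homeomorph R.symm.toHomeomorph (f := k) (μ := volume)).1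
      (by rw [LinearIsometryEquiv.coe_toHomeomorph, hmp'.map_eq]; exact hk)
  refine ⟨?_, ?_, fun φ v hφ => ?_⟩
  · rw [Opens.coe_top, locallyIntegrableOn_univ]
    refine (hli h.locallyIntegrableOn).mono (R.continuous.comp_aestronglyMeasurable (hli h.locallyIntegrableOn).aestronglyMeasurable)
      (Eventually.of_forall fun x => ?_)
    simp only [LinearIsometryEquiv.norm_map, le_refl]
  · rw [Opens.coe_top, locallyIntegrableOn_univ]
    refine (hli h.locallyIntegrableOn_deriv).mono
      ((continuous_conj R).comp_aestronglyMeasurable (hli h.locallyIntegrableOn_deriv).aestronglyMeasurable)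
      (Eventually.of_forall fun x => norm_conj_le R _)
  · rw [Opens.coe_top, Measure.restrict_univ]
    have hφR := isTestFunctionOn_top_comp R hφ
    have key := h.integral_fderiv_smul_eq (fun y => φ (R y)) (R.symm v) hφR
    rw [Opens.coe_top, Measure.restrict_univ] at key
    -- the chain rule
    have hch : ∀ y, fderiv ℝ (fun y => φ (R y)) y (R.symm v) = fderiv ℝ φ (R y) v := by
      intro y
      have := R.toContinuousLinearEquiv.comp_right_fderiv (f := φ) (x := y)
      rw [show (φ ∘ ⇑R.toContinuousLinearEquiv) = fun y => φ (R y) from rfl] at this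
      rw [this, ContinuousLinearMap.comp_apply]
      simp
    simp_rw [hch] at key
    have hcomm : ∀ F : EuclideanSpace ℝ (Fin 3) → EuclideanSpace ℝ (Fin 3), ∫ y, R (F y) = R (∫ y, F y) := fun F =>
      R.toLinearIsometry.integral_comp_comm F
    -- left side: `x = R y`
    have hL : ∫ x, (fderiv ℝ φ x v) • R (f (R.symm x)) = R (∫ y, (fderiv ℝ φ (R y) v) • f y) := by
      rw [← hcomm]
      rw [← hmp.integral_comp hme (fun x => (fderiv ℝ φ x v) • R (f (R.symm x)))]
      refine integral_congr_ae (Eventually.of_forall fun y => ?_)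
      simp only [LinearIsometryEquiv.symm_apply_apply, LinearIsometryEquiv.map_smul]
    -- right side: `x = R y`
    have hR : ∫ x, φ x • ((R : EuclideanSpace ℝ (Fin 3) →L[ℝ] EuclideanSpace ℝ (Fin 3)).comp ((g (R.symm x)).comp ((R).symm : EuclideanSpace ℝ (Fin 3) →L[ℝ] EuclideanSpace ℝ (Fin 3)))) v = R (∫ y, φ (R y) • g y (R.symm v)) := by
      rw [← hcomm]
      rw [← hmp.integral_comp hme (fun x => φ x • ((R : EuclideanSpace ℝ (Fin 3) →L[ℝ] EuclideanSpace ℝ (Fin 3)).comp ((g (R.symm x)).comp ((R).symm : EuclideanSpace ℝ (Fin 3) →L[ℝ] EuclideanSpace ℝ (Fin 3)))) v)]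
      refine integral_congr_ae (Eventually.of_forall fun y => ?_)
      simp only [conj_apply, LinearIsometryEquiv.symm_apply_apply, LinearIsometryEquiv.map_smul]
    rw [hL, hR, key, map_neg]

/-! ## Slice masses under a linear isometry -/

/-- **Ball integrals are invariant under a linear isometry**: `∫_{B_r} F(Ry) dy = ∫_{B_r} F`. [folklore] -/
theorem setLIntegral_ball_comp (R : EuclideanSpace ℝ (Fin 3) ≃ₗᵢ[ℝ] EuclideanSpace ℝ (Fin 3)) (F : EuclideanSpace ℝ (Fin 3) → ℝ≥0∞) (r : ℝ) :
    ∫⁻ y in ball (0 : EuclideanSpace ℝ (Fin 3)) r, F (R y) = ∫⁻ y in ball (0 : EuclideanSpace ℝ (Fin 3)) r, F y := by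
  have h := R.measurePreserving.setLIntegral_comp_preimage_emb R.toMeasurableEquiv.measurableEmbedding F (ball 0 r)
  have hpre : R ⁻¹' ball (0 : EuclideanSpace ℝ (Fin 3)) r = ball 0 r := by
    ext y; simp
  rwa [hpre] at h

/-- **The gauge slice mass is invariant under isometric conjugation**: `∫_{B_r} |R ∘ G(R⁻¹y) ∘ R⁻¹|²_F dy = ∫_{B_r} |G|²_F`. [folklore] -/
theorem sliceMass_conj (R : EuclideanSpace ℝ (Fin 3) ≃ₗᵢ[ℝ] EuclideanSpace ℝ (Fin 3))
    (G : EuclideanSpace ℝ (Fin 3) → EuclideanSpace ℝ (Fin 3) →L[ℝ] EuclideanSpace ℝ (Fin 3)) (r : ℝ) :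
    ∫⁻ y in ball (0 : EuclideanSpace ℝ (Fin 3)) r, ENNReal.ofReal (frobeniusNormSq ((R : EuclideanSpace ℝ (Fin 3) →L[ℝ] EuclideanSpace ℝ (Fin 3)).comp ((G (R.symm y)).comp ((R).symm : EuclideanSpace ℝ (Fin 3) →L[ℝ] EuclideanSpace ℝ (Fin 3))))) =
      ∫⁻ y in ball (0 : EuclideanSpace ℝ (Fin 3)) r, ENNReal.ofReal (frobeniusNormSq (G y)) := by
  have h1 : ∀ y, frobeniusNormSq ((R : EuclideanSpace ℝ (Fin 3) →L[ℝ] EuclideanSpace ℝ (Fin 3)).comp ((G (R.symm y)).comp ((R).symm : EuclideanSpace ℝ (Fin 3) →L[ℝ] EuclideanSpace ℝ (Fin 3)))) = frobeniusNormSq (G (R.symm y)) := fun y =>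
    frobeniusNormSq_conj_linearIsometryEquiv R _
  simp_rw [h1]
  exact setLIntegral_ball_comp R.symm (fun y => ENNReal.ofReal (frobeniusNormSq (G y))) r

/-! ## Conjugate slices have conjugate weak-gradient slices -/

/-- **CONJUGATE SLICES, CONJUGATE GRADIENTS.**  If `g` is a weak derivative of the slice `f` and `g'` one of the slice `f' = R ∘ f ∘ R⁻¹` (both on `ℝ³`),
then `g' = R ∘ g(R⁻¹·) ∘ R⁻¹` a.e. (uniqueness of weak derivatives, `HasWeakFDerivOn.unique_holds`). [folklore] -/
theorem ae_eq_conj_of_hasWeakFDerivOn (R : EuclideanSpace ℝ (Fin 3) ≃ₗᵢ[ℝ] EuclideanSpace ℝ (Fin 3))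
    {f f' : EuclideanSpace ℝ (Fin 3) → EuclideanSpace ℝ (Fin 3)} {g g' : EuclideanSpace ℝ (Fin 3) → EuclideanSpace ℝ (Fin 3) →L[ℝ] EuclideanSpace ℝ (Fin 3)}
    (h : HasWeakFDerivOn (⊤ : Opens (EuclideanSpace ℝ (Fin 3))) volume f g)
    (h' : HasWeakFDerivOn (⊤ : Opens (EuclideanSpace ℝ (Fin 3))) volume f' g') (hff' : f' = fun x => R (f (R.symm x))) :
    g' =ᵐ[volume] fun x => ((R : EuclideanSpace ℝ (Fin 3) →L[ℝ] EuclideanSpace ℝ (Fin 3)).comp ((g (R.symm x)).comp ((R).symm : EuclideanSpace ℝ (Fin 3) →L[ℝ] EuclideanSpace ℝ (Fin 3)))) := by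
  subst hff'
  have := HasWeakFDerivOn.unique_holds h' (hasWeakFDerivOn_conj R h)
  rwa [Opens.coe_top, Measure.restrict_univ] at this

variable {u : ℝ → EuclideanSpace ℝ (Fin 3) → EuclideanSpace ℝ (Fin 3)}
  {H : ℝ → EuclideanSpace ℝ (Fin 3) → EuclideanSpace ℝ (Fin 3) →L[ℝ] EuclideanSpace ℝ (Fin 3)}
  {p : ℝ → EuclideanSpace ℝ (Fin 3) → ℝ} {ρ : ℝ} {c : ℝ≥0} {T₁ : ℝ}

/-! ## Shared bookkeeping -/

/-- **Tonelli on a window box**: `∫_{(s,t) × B_a} |H|²_F = ∫_{(s,t)} (∫_{B_a} |H(τ)|²_F) dτ` for `t ≤ 0`. [folklore] -/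
theorem setLIntegral_box_eq_iterate
    (hH : HasWeakSpatialGradientOn (slab (EuclideanSpace ℝ (Fin 3)) (Iio 0) isOpen_Iio) u H) {s t : ℝ} (ht : t ≤ 0) (a : ℝ) :
    ∫⁻ z in Ioo s t ×ˢ ball (0 : EuclideanSpace ℝ (Fin 3)) a, ENNReal.ofReal (frobeniusNormSq (H z.1 z.2)) =
      ∫⁻ τ in Ioo s t, ∫⁻ y in ball (0 : EuclideanSpace ℝ (Fin 3)) a, ENNReal.ofReal (frobeniusNormSq (H τ y)) := by
  have h1 : AEStronglyMeasurable (uncurry H) (volume.restrict (Ioo s t ×ˢ ball (0 : EuclideanSpace ℝ (Fin 3)) a)) := by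
    have h0 := hH.locallyIntegrableOn_grad.aestronglyMeasurable
    rw [coe_slab] at h0
    exact h0.mono_set (Set.prod_mono (fun τ hτ => lt_of_lt_of_le hτ.2 ht) (subset_univ _))
  rw [Measure.volume_eq_prod, ← Measure.prod_restrict] at h1
  have hmeas : AEMeasurable (fun z : ℝ × EuclideanSpace ℝ (Fin 3) => ENNReal.ofReal (frobeniusNormSq (H z.1 z.2)))
      ((volume.restrict (Ioo s t)).prod (volume.restrict (ball (0 : EuclideanSpace ℝ (Fin 3)) a))) :=
    ((ENNReal.continuous_ofReal.comp LerayHopfProofs.continuous_frobeniusNormSq).comp_aestronglyMeasurable h1).aemeasurable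
  rw [Measure.volume_eq_prod, ← Measure.prod_restrict, lintegral_prod _ hmeas]

/-- **A member whose weak gradient vanishes a.e. below `T₁ ≤ 0` is trivial** (`ρ > 0`): a.e. slice below `T₁` is a.e. constant
(`PowerGaugeSteady.ae_slice_const_of_weakGradient_ae_zero`) with zero energy by the `A`-gauge (`PastPeriodic.lintegral_slice_eq_zero_of_ae_const_of_gaugeA`), and
`PastSymmetric.ae_eq_zero_of_gauge_of_pastSlicesZero`. [folklore] -/
theorem ae_eq_zero_of_weakGradient_slices_zero (hρ : 0 < ρ)
    (hsw : IsSuitableWeakSolutionOn (slab (EuclideanSpace ℝ (Fin 3)) (Iio 0) isOpen_Iio) 0 0 u p)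
    (hH : HasWeakSpatialGradientOn (slab (EuclideanSpace ℝ (Fin 3)) (Iio 0) isOpen_Iio) u H)
    (hc : ∀ a : ℝ, 0 < a → ENNReal.ofReal (a ^ (2 * ρ)) * cknA a (0 : ℝ × EuclideanSpace ℝ (Fin 3)) u +
        ENNReal.ofReal (a ^ ρ) * cknE a (0 : ℝ × EuclideanSpace ℝ (Fin 3)) H +
        ENNReal.ofReal (a ^ (2 * ρ)) * cknD a (0 : ℝ × EuclideanSpace ℝ (Fin 3)) p ≤ (c : ℝ≥0∞))
    (hT₁ : T₁ ≤ 0) (hslice0 : ∀ᵐ τ ∂(volume.restrict (Iio T₁)), H τ =ᵐ[volume] 0) :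
    uncurry u =ᵐ[volume.restrict (Iio (0 : ℝ) ×ˢ (univ : Set (EuclideanSpace ℝ (Fin 3))))] 0 := by
  have hA : ∀ a : ℝ, 0 < a → ENNReal.ofReal (a ^ (2 * ρ)) * cknA a (0 : ℝ × EuclideanSpace ℝ (Fin 3)) u ≤ (c : ℝ≥0∞) :=
    fun a ha => le_trans (le_trans le_self_add le_self_add) (hc a ha)
  have hHm : AEStronglyMeasurable (uncurry H) (volume.restrict (Iio T₁ ×ˢ (univ : Set (EuclideanSpace ℝ (Fin 3))))) := by
    have h0 := hH.locallyIntegrableOn_grad.aestronglyMeasurable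
    rw [coe_slab] at h0
    exact h0.mono_set (Set.prod_mono (Iio_subset_Iio hT₁) Subset.rfl)
  have hH0 := FrameSteady.ae_zero_of_ae_slice hHm hslice0
  have hslice := TypeIliouvilleNoTypeII.PowerGaugeSteady.ae_slice_const_of_weakGradient_ae_zero isOpen_Iio
    (hH.mono (slab_mono (Iio_subset_Iio hT₁))) hH0
  have hzero : ∀ᵐ τ ∂(volume.restrict (Iio T₁)), ∫⁻ x, ‖u τ x‖ₑ ^ 2 = 0 := by
    filter_upwards [hslice, ae_restrict_mem measurableSet_Iio] with τ hτ hτT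
    obtain ⟨b, hb⟩ := hτ
    exact PastPeriodic.lintegral_slice_eq_zero_of_ae_const_of_gaugeA hρ hA (lt_of_lt_of_le hτT hT₁) hb
  exact PastSymmetric.ae_eq_zero_of_gauge_of_pastSlicesZero hρ.le hsw hH hc hzero

/-- **Zero ball masses at all integer radii ⇒ the slice vanishes a.e.** [folklore] -/
theorem slice_ae_zero_of_ballMass_zero {G : EuclideanSpace ℝ (Fin 3) → EuclideanSpace ℝ (Fin 3) →L[ℝ] EuclideanSpace ℝ (Fin 3)}
    (hG : AEStronglyMeasurable G volume)
    (h0 : ∀ n : ℕ, ∫⁻ y in ball (0 : EuclideanSpace ℝ (Fin 3)) (n : ℝ), ENNReal.ofReal (frobeniusNormSq (G y)) = 0) :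
    G =ᵐ[volume] 0 := by
  have hball : ∀ n : ℕ, ∀ᵐ y ∂(volume.restrict (ball (0 : EuclideanSpace ℝ (Fin 3)) (n : ℝ))), G y = 0 := by
    intro n
    have hm : AEMeasurable (fun y => ENNReal.ofReal (frobeniusNormSq (G y))) (volume.restrict (ball (0 : EuclideanSpace ℝ (Fin 3)) (n : ℝ))) :=
      ((ENNReal.continuous_ofReal.comp LerayHopfProofs.continuous_frobeniusNormSq).comp_aestronglyMeasurable hG.restrict).aemeasurable
    filter_upwards [(lintegral_eq_zero_iff' hm).1 (h0 n)] with y hy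
    have h1 : frobeniusNormSq (G y) ≤ 0 := ENNReal.ofReal_eq_zero.1 hy
    have h2 : ‖G y‖ ^ 2 ≤ 0 := (sq_opNorm_le_frobeniusNormSq _).trans h1
    exact norm_eq_zero.1 (by nlinarith [norm_nonneg (G y)])
  have hU : (univ : Set (EuclideanSpace ℝ (Fin 3))) = ⋃ n : ℕ, ball (0 : EuclideanSpace ℝ (Fin 3)) (n : ℝ) := by
    ext y; simp only [mem_univ, mem_iUnion, mem_ball_zero_iff, true_iff]; exact exists_nat_gt ‖y‖
  have := (ae_restrict_iUnion_iff (μ := (volume : Measure (EuclideanSpace ℝ (Fin 3)))) (s := fun n : ℕ => ball 0 (n : ℝ))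
    (p := fun y => G y = 0)).2 hball
  rwa [← hU, Measure.restrict_univ] at this

end Twisted

end Summit.NavierStokesRegularity.NavierStokesRegularity.Theorems.PowerGaugeEulerLiouville
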